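import Mathlib
import Summits.Ventures.PercRepro2.TwoHullMasterBlockCheck

/-!
# (MM) on the triangular prism, `l` and `h` in different triangles (blind cell PercRepro2,
night-4 g40, 2026-08-29; proofs/NIGHT4-G40.md §3)

The triangular prism — triangles `{0, 3, 4}` and `{1, 2, 5}`, matching `0–5`, `3–2`, `4–1` — with
`l = 0`, `h = 1` is the smallest 3-connected graph with a `K₄` minor on which `U = {h ∉ H_l}` is
non-empty (38 configurations); no cover of `U` by arm cubes (vertex-set flips, NIGHT4-G10) exists
there, not even a fractional one, while `U` is the disjoint union of 9 monotone cube blocks with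
EDGE-SET classes (`prismBlocks`, found by exhaustive search: every family of ≤ 4 disjoint edge
classes at every point).  The checker of TwoHullMasterBlockCheck.lean accepts the cover by a kernel
computation, and **`twoHullMaster_prism`** is (MM) on the prism for EVERY pair of up-sets — hence
row (SW) for every mark `o` (`sw_prism`).  The graph of NIGHT4-G38 §7 (the last two pairs at
`n = 7`) is this prism with the matching edge `0–1`… subdivided; see TwoHullMasterPrismSub.lean.
-/

namespace Summit.Ventures.PercRepro2

namespace Prism

open Hull LocRows SwCheck BlockCheck

/-- The triangular prism on `Fin 6`: edges `03 04 05 12 14 15 23 25 34` (in this order). -/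
def prismEdges : List (Fin 6 × Fin 6) :=
  [(0, 3), (0, 4), (0, 5), (1, 2), (1, 4), (1, 5), (2, 3), (2, 5), (3, 4)]

/-- The cube cover of `U` for `l = 0`, `h = 1`: nine blocks `(base, classes)`, bit `i` of a mask =
edge `i` of `prismEdges`; the base of each block is its bottom point. -/
def prismBlocks : List (ℕ × List ℕ) :=
  [(440, [228, 283]), (504, [420, 91]), (376, [136, 375]), (120, [136, 375]), (248, [511]),
    (312, [18, 385, 108]), (184, [275, 236]), (57, [108, 403]), (56, [275, 236])]

/-- The checker accepts the cover (kernel computation). -/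
theorem checkCover_prism : checkCover prismEdges 0 1 prismBlocks = true := by
  decide +kernel

/-- **(MM) on the triangular prism**, `l = 0` and `h = 1` in different triangles. -/
theorem twoHullMaster_prism : TwoHullMaster (endsOf prismEdges) 0 1 :=
  twoHullMaster_of_checkCover prismEdges 0 1 prismBlocks checkCover_prism

/-- Row (SW) on the prism for every mark `o`. -/
theorem sw_prism (o : Fin 6) : Sw (endsOf prismEdges) 0 1 o :=
  sw_of_twoHullMaster o twoHullMaster_prism

end Prism

end Summit.Ventures.PercRepro2
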